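import Summits.BirchSwinnertonDyer.BirchSwinnertonDyer.Theorems.PrintCf2DisegniPairTwoFrameCoreFixing
import Summits.BirchSwinnertonDyer.BirchSwinnertonDyer.Theorems.PrintCf2DisegniPairTwoFrameMinimal
import Literature.NumberTheory.DiophantineGeometry.LocalReductionProofs
import Literature.NumberTheory.EllipticCurves.LFunctionSmulProofs
import HarnessLib

/-!
# Road (C) `disegni-pair-two` on crux stmt-BirchSwinnertonDyer-20368 — the FRAME CORE at a GIVEN model of the good partner

Cell `bsd-print-cf2`, LEAD `bsd-line-cf2-p1` g26 (`--supports stmt-BirchSwinnertonDyer-20368`, helper). THEOREMS ONLY (no `def`,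
no named fact introduced, no `sorry`); conditional on every displayed hypothesis. BSD is not proved by any of this; no summit
statement is claimed; 20368 is not closed here.

Purpose: the TIGHTNESS direction of the line (`(Δ1) ⟸ BSD₂ of the 7-free members`, file `…LawTightness.lean`) runs the Disegni
pair frame at the DATA QUANTIFIED IN (Δ1) — an ARBITRARY globally minimal model `V` of `49a1^{(d′)}` (`C₁ • V = 49a1^{(d′)}`), an
ARBITRARY cusp form `f` with `IsNewformOf V f`, the member's model `C • W = V^{(d*)}` — instead of the reference partner
`W_k = [1, −(3k+1), 0, −2d′², −d′³]` chosen by `frame_core_fixing`. Everything `frame_core_fixing` proves about `W_k` is either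
generic in `V` already (ordinarity, good reduction at `2`, the odd twist `V′`, the tower, the sign character) or an ISOMORPHISM
INVARIANT transported along `V = C₂ • W_k` (`C₂ = C₁⁻¹ C₁,₀`): good reduction at a place (`hasGoodReductionAt_smul_iff_holds`,
AEC VII.5.1) and the Dirichlet coefficients `aₙ` (`LFunction_smul`).

* §1 `baseChange_isGloballyMinimal_of_hasGoodReductionAtPrime_two` — the base-change minimality `V ⊗ H` globally minimal for the
  tower `H = K(√a)`, `a ∈ {2, −1, −2}`, for ANY globally minimal `V/ℚ` good at `2` and at the primes of `d_K` (the proof of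
  `partner_baseChange_isGloballyMinimal` verbatim with the one model-specific line — good reduction of `W_k` at `2` — replaced by
  the hypothesis).
* §2 ★ `frame_core_fixing_of_model` — `frame_core_fixing` with `V`, `C₁`, `f`, `C` GIVEN: the Friedberg–Hoffstein field `K` (`2` split,
  `𝔭 ≠ 𝔭′`, Kronecker character `κ`), the odd twist `V′ ≅ V^{(d_K)}` (globally minimal, ordinary at `2`, `a₂` equal), a newform
  `f′` of `V′` with `a(f′) = κ·a(f)`, newforms `g, g′` of `W`, `W′ = W^{(d_K)}` with `a(g) = χ_{d*}·a(f)`, `a(g′) = χ_{d*}·a(f′)`,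
  `L(W′,1) ≠ 0`, `L(W,1) = 0`, the tower `H = K(√d*)` WITH `V ⊗ H` globally minimal, its sign character, `u = √d_K`, the
  conjugation, and the torsion of the companion twist `(V^{(d*)})^{(d_K)}(ℚ)`.

References: J. H. Silverman, AEC (2009) VII.5 Prop. 5.1, X.2 Prop. 2.4 [SilvermanAEC2009]; S. Friedberg, J. Hoffstein,
Ann. of Math. 142 (1995) [FriedbergHoffstein1995]; D. Disegni, Compos. Math. 153 (2017) §1.1 [Disegni2017].
-/

set_option linter.dupNamespace false

noncomputable section

open scoped Classical MatrixGroups ModularForm NumberField NumberTheorySymbols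

open CongruenceSubgroup NumberField IsDedekindDomain WeierstrassCurve WeierstrassCurve.Affine.Point
  Literature.NumberTheory.EllipticCurves Literature.NumberTheory.EllipticCurves.ModularForms

namespace Summit.BirchSwinnertonDyer.BirchSwinnertonDyer.Theorems.PrintCf2.DisegniPairTwo

/-! ### §1 Base-change minimality over the tower, for any globally minimal model good at `2` and at the primes of `d_K` -/

/-- **`V ⊗ H` is globally minimal** for `V/ℚ` globally minimal with good reduction at `2` and at the primes of `d_K` (`K` imaginary
quadratic) and `H ⊇ K` quadratic generated by `t`, `t² = a ∈ {2, −1, −2}`: every place `w` of `H` lies over a good prime of `V` or is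
unramified over `ℚ` (`isGloballyMinimal_baseChange_rat`); a bad place lies over an ODD prime `q ∤ d_K`, and there
`e(w|q) = e(w_K|q)·e(w|w_K) = 1·1` by the square-root different criterion (`ramificationIdx_eq_one_of_sq_eq_int` at `x = √d_K` and
`x = √a`). (= `partner_baseChange_isGloballyMinimal` with the model `W_k` replaced by the hypothesis «good at `2`».)
[cite: SilvermanAEC2009, Prop. VII.5.4 (a) and VIII.8] [cite: NeukirchANT1999, Ch. III (2.6)] -/
theorem baseChange_isGloballyMinimal_of_hasGoodReductionAtPrime_two
    (V : WeierstrassCurve ℚ) [V.IsElliptic] [V.IsGloballyMinimal] (hV2 : V.HasGoodReductionAtPrime 2)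
    (K : Type) [Field K] [NumberField K] (hK : IsImaginaryQuadratic K)
    (hgood : ∀ v : HeightOneSpectrum (𝓞 ℚ), ((Rat.HeightOneSpectrum.primesEquiv v : ℕ) : ℤ) ∣ NumberField.discr K →
      V.HasGoodReductionAt v)
    (H : Type) [Field H] [NumberField H] [Algebra K H] (hKH : Module.finrank K H = 2)
    (a : ℚ) (ha : a = 2 ∨ a = -1 ∨ a = -2) (t : H) (htK : t ∉ Set.range (algebraMap K H))
    (ht2 : t ^ 2 = algebraMap ℚ H a) :
    (V.baseChange H).IsGloballyMinimal := by
  have h2K : Module.finrank ℚ K = 2 := hK.1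
  refine WeierstrassCurve.isGloballyMinimal_baseChange_rat V H (fun w => ?_)
  by_cases hgw : V.HasGoodReductionAt (w.under (𝓞 ℚ))
  · exact Or.inr hgw
  left
  set v : HeightOneSpectrum (𝓞 ℚ) := w.under (𝓞 ℚ) with hv
  set q : ℕ := (Rat.HeightOneSpectrum.primesEquiv v : ℕ) with hq
  have hqp : q.Prime := (Rat.HeightOneSpectrum.primesEquiv v).2
  -- the bad place lies over an odd prime not dividing `d_K`
  have hq2 : q ≠ 2 := fun h => hgw ((hasGoodReductionAtPrime_primesEquiv_iff_holds V v 2 h).mp hV2)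
  have hqD : ¬ (q : ℤ) ∣ NumberField.discr K := fun h => hgw (hgood v h)
  have hq4 : ∀ m : ℤ, (m = 2 ∨ m = -1 ∨ m = -2 ∨ m = NumberField.discr K) → ¬ (q : ℤ) ∣ 4 * m := by
    intro m hm hdvd
    have hqZ : Prime (q : ℤ) := Nat.prime_iff_prime_int.mp hqp
    have h4 : ¬ (q : ℤ) ∣ 4 := fun h => by
      have := (Nat.prime_dvd_prime_iff_eq hqp Nat.prime_two).mp
        (by exact_mod_cast (hqZ.dvd_of_dvd_pow (show (q : ℤ) ∣ 2 ^ 2 by norm_num; exact h)))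
      exact hq2 this
    rcases hqZ.dvd_or_dvd hdvd with h | h
    · exact h4 h
    · rcases hm with rfl | rfl | rfl | rfl
      · have : (q : ℤ) ∣ 2 := h
        have := (Nat.prime_dvd_prime_iff_eq hqp Nat.prime_two).mp (by exact_mod_cast this)
        exact hq2 this
      · have := Int.eq_one_of_dvd_one (by positivity) (dvd_neg.mp h)
        have h2 := hqp.two_le
        omega
      · have : (q : ℤ) ∣ 2 := (dvd_neg.mp h)
        have := (Nat.prime_dvd_prime_iff_eq hqp Nat.prime_two).mp (by exact_mod_cast this)
        exact hq2 this
      · exact hqD h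
  -- the intermediate place `w_K`
  set wK : HeightOneSpectrum (𝓞 K) := w.under (𝓞 K) with hwK
  have hwKv : wK.under (𝓞 ℚ) = v := by
    ext1
    rw [HeightOneSpectrum.under_asIdeal, HeightOneSpectrum.under_asIdeal, hv, HeightOneSpectrum.under_asIdeal,
      Ideal.under_under]
  -- step 1: `e(w_K | q) = 1` via `x = √d_K`
  obtain ⟨u, hu, hue⟩ := exists_sqrt_discr hK
  have hue' : u ^ 2 = algebraMap ℚ K ((NumberField.discr K : ℤ) : ℚ) := hue
  have e₁ : wK.asIdeal.ramificationIdx (𝓞 ℚ) = 1 := by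
    refine ramificationIdx_eq_one_of_sq_eq_int (E := ℚ) h2K hu (m := NumberField.discr K) hue' wK ?_
    have := valuation_intCast_eq_one_of_not_dvd wK (4 * NumberField.discr K)
      (by rw [hwKv]; exact hq4 _ (Or.inr (Or.inr (Or.inr rfl))))
    exact_mod_cast this
  -- step 2: `e(w | w_K) = 1` via `x = √a`, `a ∈ {2, −1, −2}`
  obtain ⟨m, hm, hma⟩ : ∃ m : ℤ, (m = 2 ∨ m = -1 ∨ m = -2 ∨ m = NumberField.discr K) ∧ (a : ℚ) = (m : ℚ) := by
    rcases ha with rfl | rfl | rfl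
    · exact ⟨2, Or.inl rfl, by norm_num⟩
    · exact ⟨-1, Or.inr (Or.inl rfl), by norm_num⟩
    · exact ⟨-2, Or.inr (Or.inr (Or.inl rfl)), by norm_num⟩
  have htd : t ^ 2 = algebraMap K H (m : K) := by
    rw [ht2, hma, map_intCast, map_intCast]
  have e₂ : w.asIdeal.ramificationIdx (𝓞 K) = 1 := by
    refine ramificationIdx_eq_one_of_sq_eq_int (E := K) hKH htK htd w ?_
    have := valuation_intCast_eq_one_of_not_dvd w (4 * m) (hq4 m hm)
    exact_mod_cast this
  -- tower
  haveI : w.asIdeal.LiesOver (w.asIdeal.under (𝓞 K)) := ⟨rfl⟩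
  have htower := Ideal.ramificationIdx_tower (R := 𝓞 ℚ) (w.asIdeal.under (𝓞 K)) w.asIdeal
  have e₁' : (w.asIdeal.under (𝓞 K)).ramificationIdx (𝓞 ℚ) = 1 := by
    rw [← HeightOneSpectrum.under_asIdeal]; exact e₁
  rw [htower, e₁', e₂]

/-! ### §2 The frame core at a given model `V`, a given newform `f` of `V`, and the member's given model `C • W = V^{(d*)}` -/

set_option maxHeartbeats 800000 in
/-- ★ **THE DISEGNI PAIR FRAME — CORE, `K`-FIXING FORM, AT A GIVEN MODEL.** As `frame_core_fixing`, but for an ARBITRARY globally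
minimal model `V` of the good partner (`C₁ • V = 49a1^{(d′)}`, `d′ ≡ 1 (4)` squarefree), an ARBITRARY cusp form `f` with
`IsNewformOf V f`, and the member's GIVEN model `C • W = V^{(d*)}` (`d* ∈ {2, −1, −2}`, `r_an(W) = 1`): the Friedberg–Hoffstein
field `K` with `2` split and its Kronecker character `κ`; the odd twist `V′ ≅ V^{(d_K)}` (globally minimal, ordinary at `2`,
`a₂(V′) = a₂(V)`); `V` good at the primes of `d_K` (TRANSPORTED from the reference partner `W_k` of `exists_goodPartner_model` along
the `ℚ`-isomorphism `V = (C₁⁻¹C₁,₀) • W_k`: `hasGoodReductionAt_smul_iff_holds`); a newform `f′` of `V′` with `a(f′) = κ·a(f)`;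
newforms `g, g′` of `W` and `W′ = W^{(d_K)}` with `a(g) = χ_{d*}·a(f)` (`aₘ(W) = χ_{d*}(m)aₘ(W_k)` by `LFunction_member_eq`,
`aₘ(W_k) = aₘ(V)` by `LFunction_smul`), `a(g′) = χ_{d*}·a(f′)`, `L(W′,1) ≠ 0`, `L(W,1) = 0`; the tower `H = K(√d*)` with
`V ⊗ H` GLOBALLY MINIMAL (§1), its sign character `χ : G = Gal(H/K) → {±1}`, the element `τ` with `τ t = −t`; `u = √d_K`, the
conjugation `c u = −u`; and every `ℚ`-point of the companion twist `(V^{(d*)})^{(d_K)} ≅ W′` is torsion (`rank W′ = r_an W′ = 0`,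
GZK). Inputs: modularity continuation, newform existence, Friedberg–Hoffstein, GZK.
[cite: FriedbergHoffstein1995, main theorem] [cite: SilvermanAEC2009, VII.5 Prop. 5.1, X.2 and X.5]
[cite: Disegni2017, §1.1.1 (arXiv v3 PDF p. 3)] [cite: GrossZagier1986, Thm. I.(7.3)] -/
theorem frame_core_fixing_of_model (hmod : hasEntireLFunction_rat) (hnew : exists_isNewformOf)
    (hFH : friedbergHoffstein_exists_heegnerField_split_twist_ne_zero)
    (hrank : rank_eq_analyticRank_of_analyticRank_le_one)
    {ds d' : ℤ} (hds : ds = 2 ∨ ds = -1 ∨ ds = -2) (hd4 : d' % 4 = 1) (hsq : Squarefree d')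
    (V : WeierstrassCurve ℚ) [V.IsElliptic] [V.IsGloballyMinimal] (C₁ : VariableChange ℚ)
    (hC₁ : C₁ • V = cm7.quadraticTwist (d' : ℚ))
    {N : ℕ} [NeZero N] {f : CuspForm (Gamma0 N) 2} (hf : IsNewformOf V f)
    (W : WeierstrassCurve ℚ) [W.IsElliptic] [W.IsGloballyMinimal] [(V.quadraticTwist (ds : ℚ)).IsElliptic]
    {C : VariableChange ℚ} (hC : C • W = V.quadraticTwist (ds : ℚ)) (hr : W.analyticRank = 1) :
    ∃ (K : Type) (_ : Field K) (_ : NumberField K) (_ : IsGalois ℚ K),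
      IsImaginaryQuadratic K ∧ Module.finrank ℚ K = 2 ∧
      ((Ideal.span {(2 : ℤ)}).primesOver (𝓞 K)).ncard = 2 ∧
    ∃ (𝔭 𝔭' : HeightOneSpectrum (𝓞 K)), ((2 : ℕ) : 𝓞 K) ∈ 𝔭.asIdeal ∧ ((2 : ℕ) : 𝓞 K) ∈ 𝔭'.asIdeal ∧ 𝔭 ≠ 𝔭' ∧
    ∃ (κ : DirichletCharacter ℂ (NumberField.discr K).natAbs),
      (∀ ℓ : ℕ, ℓ.Prime → ℓ ≠ 2 → κ ℓ = (jacobiSym (NumberField.discr K) ℓ : ℂ)) ∧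
      (κ 2 = if NumberField.discr K % 8 = 1 then 1 else if NumberField.discr K % 8 = 5 then -1 else 0) ∧
      Nat.Coprime 2 (NumberField.discr K).natAbs ∧
    ∃ (V' : WeierstrassCurve ℚ) (_ : V'.IsElliptic) (_ : V'.IsGloballyMinimal),
      IsOrdinaryAt V 2 ∧ IsOrdinaryAt V' 2 ∧ V'.frobeniusTrace 2 = V.frobeniusTrace 2 ∧
      (∀ v : HeightOneSpectrum (𝓞 ℚ), ((Rat.HeightOneSpectrum.primesEquiv v : ℕ) : ℤ) ∣ NumberField.discr K →
        V.HasGoodReductionAt v) ∧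
    ∃ (N' : ℕ) (_ : NeZero N') (f' : CuspForm (Gamma0 N') 2),
      IsNewformOf V' f' ∧ (∀ n : ℕ, cuspCoeff f' n = κ (n : ZMod _) * cuspCoeff f n) ∧
    ∃ (M M' : ℕ) (_ : NeZero M) (_ : NeZero M') (g : CuspForm (Gamma0 M) 2) (g' : CuspForm (Gamma0 M') 2)
      (W' : WeierstrassCurve ℚ) (_ : W'.IsElliptic),
      IsNewformOf W g ∧ IsNewformOf W' g' ∧
      (∀ m : ℕ, cuspCoeff g m = (((if Even m then 0 else J(ds | m) : ℤ)) : ℂ) * cuspCoeff f m) ∧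
      (∀ m : ℕ, cuspCoeff g' m = (((if Even m then 0 else J(ds | m) : ℤ)) : ℂ) * cuspCoeff f' m) ∧
      W'.entireLFunction 1 ≠ 0 ∧ W.entireLFunction 1 = 0 ∧
    ∃ (H : Type) (_ : Field H) (_ : NumberField H) (_ : Algebra K H) (_ : (V.baseChange H).IsGloballyMinimal)
      (_ : Module.finrank K H = 2) (t : H)
      (_ : t ∉ Set.range (algebraMap K H)) (_ : t ^ 2 = algebraMap ℚ H (ds : ℚ))
      (G : Subgroup (H ≃ₐ[ℚ] H)) (χ : G →* ℂˣ) (s : G → ℤ) (_ : ∀ σ, ((χ σ : ℂˣ) : ℂ) = (s σ : ℂ))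
      (_ : ∀ (σ : G) (a : K), σ.1 (algebraMap K H a) = algebraMap K H a)
      (τ : H ≃ₐ[ℚ] H) (hτG : τ ∈ G), s ⟨τ, hτG⟩ = -1 ∧ (∀ a : K, τ (algebraMap K H a) = algebraMap K H a) ∧
      τ t = -t ∧
    ∃ (u : K) (e : ℚ), u ∉ Set.range (algebraMap ℚ K) ∧ u ^ 2 = algebraMap ℚ K e ∧
    ∃ (c : K ≃ₐ[ℚ] K), c u = -u ∧
      (∀ Q : ((V.quadraticTwist (ds : ℚ)).quadraticTwist e).toAffine.Point, IsOfFinAddOrder Q) := by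
  -- §A the reference partner `W_k` (`exists_goodPartner_model`) and the isomorphism `V = C₂ • W_k`
  set C₀ : VariableChange ℚ := (⟨C₁.u, (ds : ℚ) * C₁.r, 0, 0⟩ : VariableChange ℚ) * C with hC₀def
  have hC₀ : C₀ • W = cm7.quadraticTwist (((ds * d' : ℤ)) : ℚ) := by
    rw [hC₀def, mul_smul, hC, ← quadraticTwist_smul, hC₁, quadraticTwist_quadraticTwist,
      show (d' : ℚ) * (ds : ℚ) = (((ds * d' : ℤ)) : ℚ) by push_cast; ring]
  obtain ⟨k, V₀, hk, hV₀, hV₀ell, hV₀min, ⟨C₁₀, hC₁₀⟩, C₀', hC₀'⟩ := exists_goodPartner_model hd4 hsq W C₀ hC₀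
  haveI := hV₀ell
  haveI := hV₀min
  have hVV₀ : (C₁⁻¹ * C₁₀) • V₀ = V := by rw [mul_smul, hC₁₀, ← hC₁, inv_smul_smul]
  subst hk
  have hds0 : ds ≠ 0 := by rcases hds with rfl | rfl | rfl <;> decide
  have hdsQ : (ds : ℚ) ≠ 0 := Int.cast_ne_zero.mpr hds0
  have hordV : IsOrdinaryAt V 2 := isOrdinaryAt_two_of_cm7_quadraticTwist hd4 V C₁ hC₁
  have hV2 : V.HasGoodReductionAtPrime 2 := cm7_quadraticTwist_hasGoodReductionAtPrime_two hd4 V C₁ hC₁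
  have hLV₀ : V.LFunction = V₀.LFunction := by rw [← hVV₀, LFunction_smul]
  -- §B the Friedberg–Hoffstein field
  obtain ⟨K, hKf, hKn, hKg, hK, h2K, hsplit, ⟨𝔭, 𝔭', h𝔭, h𝔭', hne⟩, h8, hsqD, hDneg, hgoodW, hL'⟩ :=
    exists_heegnerField hnew hFH W hr
  obtain ⟨κ, hκ, hκ2, hcop, hκn⟩ := exists_kroneckerChar K h8
  have hD0 : NumberField.discr K ≠ 0 := hDneg.ne
  have hD0Q : ((NumberField.discr K : ℤ) : ℚ) ≠ 0 := Int.cast_ne_zero.mpr hD0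
  have hD4 : NumberField.discr K % 4 = 1 := by omega
  -- `V` is good at the (odd, ramified) primes of `d_K`: transported from `W_k` along `V = C₂ • W_k`
  have hgoodV : ∀ v : HeightOneSpectrum (𝓞 ℚ), ((Rat.HeightOneSpectrum.primesEquiv v : ℕ) : ℤ) ∣ NumberField.discr K →
      V.HasGoodReductionAt v := by
    intro v hv
    have h₀ : V₀.HasGoodReductionAt v := by
      refine hasGoodReductionAt_partner_of_member V₀ k hV₀ hsq hC₁₀ hds hC₀' v (fun h2 => ?_) (hgoodW v hv)
      rw [h2] at hv
      have : (2 : ℤ) ∣ NumberField.discr K := by exact_mod_cast hv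
      omega
    rw [← hVV₀]
    exact (hasGoodReductionAt_smul_iff_holds v V₀ (C₁⁻¹ * C₁₀)).mpr h₀
  -- §C the odd twist `V′ ≅ V^{(d_K)}`, globally minimal, ordinary at `2`, `a₂` equal
  haveI hVD : (V.quadraticTwist ((NumberField.discr K : ℤ) : ℚ)).IsElliptic := V.isElliptic_quadraticTwist hD0Q
  obtain ⟨V', hV'ell, hV'min, C', hC'⟩ : ∃ (V' : WeierstrassCurve ℚ) (_ : V'.IsElliptic) (_ : V'.IsGloballyMinimal)
      (C' : VariableChange ℚ), C' • V' = V.quadraticTwist ((NumberField.discr K : ℤ) : ℚ) := by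
    obtain ⟨C', hC'min⟩ := hasGlobalMinimalModel_rat_holds (V.quadraticTwist ((NumberField.discr K : ℤ) : ℚ))
    exact ⟨C' • V.quadraticTwist ((NumberField.discr K : ℤ) : ℚ), inferInstance, hC'min, C'⁻¹, inv_smul_smul C' _⟩
  haveI := hV'ell
  haveI := hV'min
  have hmodel' : ((⟨C₁.u, ((NumberField.discr K : ℤ) : ℚ) * C₁.r, 0, 0⟩ : VariableChange ℚ) * C') • V' =
      cm7.quadraticTwist ((((4 * k + 1) * NumberField.discr K : ℤ)) : ℚ) := by
    rw [mul_smul, hC', show ((((4 * k + 1) * NumberField.discr K : ℤ)) : ℚ) =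
      (((4 * k + 1 : ℤ)) : ℚ) * ((NumberField.discr K : ℤ) : ℚ) by push_cast; ring, ← quadraticTwist_quadraticTwist,
      ← hC₁, quadraticTwist_smul]
  have hd4' : ((4 * k + 1) * NumberField.discr K) % 4 = 1 := by
    rw [Int.mul_emod, hd4, hD4]; norm_num
  have hordV' : IsOrdinaryAt V' 2 := isOrdinaryAt_two_of_cm7_quadraticTwist hd4' V' _ hmodel'
  have hap : V'.frobeniusTrace 2 = V.frobeniusTrace 2 :=
    frobeniusTrace_two_partnerTwist_eq V h8 hsqD hgoodV hordV.1 hC' hordV'.1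
  -- §D newforms and coefficient identities (`f` is the given newform of `V`)
  haveI hV'N : NeZero (V'.conductorNorm ℤ) := ⟨(conductorNorm_pos_holds V').ne'⟩
  haveI hWN : NeZero (W.conductorNorm ℤ) := ⟨(conductorNorm_pos_holds W).ne'⟩
  obtain ⟨f', hf'⟩ := hnew V'
  have hLV' : ∀ n : ℕ, V'.LFunction n = J((n : ℤ) | (NumberField.discr K).natAbs) * V.LFunction n :=
    LFunction_partnerTwist_eq V hD4 hsqD hgoodV hC'
  have hV'coef : ∀ n : ℕ, cuspCoeff f' n = κ (n : ZMod _) * cuspCoeff f n := fun n => by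
    rw [hf'.2 n, hf.2 n, hκn n, hLV' n, Int.cast_mul]
  obtain ⟨W', hW'def⟩ : ∃ W' : WeierstrassCurve ℚ, W' = W.quadraticTwist ((NumberField.discr K : ℤ) : ℚ) := ⟨_, rfl⟩
  haveI hW'ell : W'.IsElliptic := by rw [hW'def]; exact W.isElliptic_quadraticTwist hD0Q
  haveI hW'N : NeZero (W'.conductorNorm ℤ) := ⟨(conductorNorm_pos_holds W').ne'⟩
  have hL'' : W'.entireLFunction 1 ≠ 0 := by rw [hW'def]; exact hL'
  obtain ⟨g, hg⟩ := hnew W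
  obtain ⟨g', hg'⟩ := hnew W'
  have hLW : ∀ m : ℕ, W.LFunction m = (if Even m then 0 else J(ds | m)) * V.LFunction m := fun m => by
    rw [hLV₀]; exact LFunction_member_eq V₀ k hV₀ hds hC₀' m
  have hLW' : ∀ m : ℕ, W'.LFunction m = J((m : ℤ) | (NumberField.discr K).natAbs) * W.LFunction m := by
    rw [hW'def]; exact W.LFunction_quadraticTwist_apply_of_emod_four_eq_one hD4 hsqD hgoodW
  have hgε : ∀ m : ℕ, cuspCoeff g m = (((if Even m then 0 else J(ds | m) : ℤ)) : ℂ) * cuspCoeff f m := fun m => by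
    rw [hg.2 m, hf.2 m, hLW m, Int.cast_mul]
  have hg'ε : ∀ m : ℕ, cuspCoeff g' m = (((if Even m then 0 else J(ds | m) : ℤ)) : ℂ) * cuspCoeff f' m := fun m => by
    rw [hg'.2 m, hLW' m, hLW m, hV'coef m, hκn m, hf.2 m]
    push_cast
    ring
  have hL0 : W.entireLFunction 1 = 0 := entireLFunction_one_eq_zero_of_analyticRank_eq_one hr
  -- §E the tower `H = K(√d*)`, `V ⊗ H` globally minimal (§1), and the sign character
  have hdsmem : (ds : ℚ) = 2 ∨ (ds : ℚ) = -1 ∨ (ds : ℚ) = -2 := by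
    rcases hds with rfl | rfl | rfl <;> norm_num
  obtain ⟨H, hHf, hHn, hHa, hKH, t, htK, ht2⟩ := exists_tower_sqrt hK hsplit (a := (ds : ℚ)) hdsmem
  haveI hVH : (V.baseChange H).IsGloballyMinimal :=
    baseChange_isGloballyMinimal_of_hasGoodReductionAtPrime_two V hV2 K hK hgoodV H hKH (ds : ℚ) hdsmem t htK ht2
  have ht0 : t ≠ 0 := fun h => htK ⟨0, by rw [_root_.map_zero, h]⟩
  have htd : t ^ 2 = algebraMap K H (algebraMap ℚ K (ds : ℚ)) := sq_eq_algebraMap_tower ht2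
  obtain ⟨G, χ, s, hG, hs, hsign⟩ := exists_relGal_signCharacter htd ht0
  obtain ⟨τ, hτK, hτt⟩ := exists_algEquiv_tower hKH htK htd
  obtain ⟨hτG, hsτ⟩ := mem_and_sign_of_apply_eq_neg ht0 hG hsign τ hτK hτt
  have hGK : ∀ (σ : G) (a : K), σ.1 (algebraMap K H a) = algebraMap K H a := fun σ => (hG σ.1).mp σ.2
  -- §F `u = √d_K`, the conjugation
  obtain ⟨u, hu, hue⟩ := exists_sqrt_discr hK
  obtain ⟨cc, hcu⟩ := exists_algEquiv_neg_sqrt h2K hu hue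
  -- §G the companion twist `(V^{(d*)})^{(d_K)} ≅ W′` is torsion (`rank W′ = r_an W′ = 0`)
  obtain ⟨C'', hC''⟩ := exists_smul_quadraticTwist_of_smul_eq hC ((NumberField.discr K : ℤ) : ℚ)
  rw [← hW'def] at hC''
  have hW'r : W'.analyticRank = 0 := (W'.analyticRank_eq_zero_iff_holds (hmod W')).mpr hL''
  have hW'rk : W'.mordellWeilRank = 0 := by
    have h := (hrank W' (by rw [hW'r]; exact zero_le_one)).1
    rw [h, hW'r]
  have htors := forall_isOfFinAddOrder_of_smul_eq W' C'' hC'' (isOfFinAddOrder_of_mordellWeilRank_eq_zero W' hW'rk)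
  -- §H assemble (staged, to keep each unification shallow)
  refine ⟨K, hKf, hKn, hKg, hK, h2K, hsplit, 𝔭, 𝔭', h𝔭, h𝔭', hne, κ, hκ, hκ2, hcop, ?_⟩
  refine ⟨V', hV'ell, hV'min, hordV, hordV', hap, hgoodV, ?_⟩
  refine ⟨V'.conductorNorm ℤ, hV'N, f', hf', hV'coef, ?_⟩
  refine ⟨W.conductorNorm ℤ, W'.conductorNorm ℤ, hWN, hW'N, g, g', W', hW'ell, hg, hg', hgε, hg'ε, hL'', hL0, ?_⟩
  refine ⟨H, hHf, hHn, hHa, hVH, hKH, t, htK, ht2, G, χ, s, hs, hGK, τ, hτG, hsτ, hτK, hτt, ?_⟩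
  refine ⟨u, ((NumberField.discr K : ℤ) : ℚ), hu, hue, cc, hcu, ?_⟩
  -- (the `DecidableEq ℚ` instance inside `E(ℚ)`'s group law: classical in the Mordell–Weil lemmas, computable here;
  -- they agree by subsingleton elimination)
  convert htors

end Summit.BirchSwinnertonDyer.BirchSwinnertonDyer.Theorems.PrintCf2.DisegniPairTwo

end
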